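import Summits.QuantumAdvantage.QuantumAdvantage.Theorems.CubicForrelationNearExactIsExactTenBalanced

/-!
# Crux `CubicForrelation.NearExactIsExact` (stmt-QuantumAdvantage-14043), line `direct-sum-amplification`, lead c6 cycle 2:
  the window corollary of the balanced-split exclusion at `n = 10`, `θ = 7/8`

`ten_window_derivative_unbalanced`: for cubic `f, g` on 10 bits with `7/8 < Φ(f,g) < 1`, the split covector `c` of `g`
exists (`W_g = 16u`, `[u(x) odd] = [c·x = b₀]`, `c ≠ 0`: the landed `split_ten` read through `stub_affineForm`) and the
derivative `D_c g` is an UNBALANCED quadratic (`ten_splitDerivative_unbalanced`).  By `Φ(f,g) = Φ(g,f)` the same holds for `f`.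
What remains of the `n = 10`, `θ = 7/8` isolation is the unbalanced split (see the crux NOTES).  Axioms: the standard three.
-/

set_option linter.dupNamespace false -- D-0017: single-problem summit ⇒ `QuantumAdvantage.QuantumAdvantage` by design

noncomputable section

namespace Summit.QuantumAdvantage.QuantumAdvantage.Theorems.CubicForrelation.NearExactIsExact

open Finset
open Literature.Computability.QuantumComplexity
open Literature.Computability.QuantumComplexity.BuzetChailloux (bxor zeroVec)
open Literature.Computability.QuantumComplexity.DerivativeWalsh (W)
open Summit.QuantumAdvantage.QuantumAdvantage.Theorems.SignedExactCubicForrelationNotPrBPP (eq_of_signOf_eq)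

/-- **In the window `7/8 < Φ(f,g) < 1` on 10 bits the split covector `c` of the cubic `g` exists (`W_g = 16u`,
`[u(x) odd] = [c·x = b₀]`, `c ≠ 0`: the landed `split_ten` read through `stub_affineForm`) and the derivative `D_c g`
is an UNBALANCED quadratic** — the balanced split case of the `n = 10`, `θ = 7/8` isolation is empty (by the symmetry
`Φ(f,g) = Φ(g,f)` the same holds for `f`). [this line: lead c6] -/
theorem ten_window_derivative_unbalanced :
    ∀ f g : (Fin (5 + 5) → Bool) → Bool, IsDegLeFun 3 f → IsDegLeFun 3 g →
      7 / 8 < forrelation f g → forrelation f g < 1 →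
      ∃ (u : (Fin (5 + 5) → Bool) → ℤ) (c : Fin (5 + 5) → Bool) (b₀ : Bool),
        (∀ x, W (fun y => signOf (g y)) x = (2 : ℝ) ^ 4 * (u x : ℝ)) ∧
        (∀ x, signOf (decide (Odd (u x))) = signOf b₀ * twist c x) ∧ c ≠ zeroVec ∧
        ∑ y, signOf (g y ^^ g (bxor y c)) ≠ 0 := by
  intro f g hf hg hΦ hΦ1
  obtain ⟨u, hu, hP, hodd, heven⟩ := split_ten f g hf hg hΦ hΦ1
  obtain ⟨c, b₀, hc⟩ := stub_affineForm _ _ hP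
  have hodd' : ∃ x, Odd (u x) := hodd
  have heven' : ∃ x, ¬ Odd (u x) := heven
  refine ⟨u, c, b₀, hu, hc, ?_, ?_⟩
  · rintro rfl
    obtain ⟨x₁, hx₁⟩ := hodd'
    obtain ⟨x₂, hx₂⟩ := heven'
    have h1 := hc x₁
    have h2 := hc x₂
    have htw : ∀ x : Fin (5 + 5) → Bool, twist (zeroVec : Fin (5 + 5) → Bool) x = 1 := fun x => by
      unfold twist; exact Finset.prod_eq_one fun i _ => by simp [BuzetChailloux.zeroVec]
    rw [htw, mul_one] at h1 h2
    have e1 := eq_of_signOf_eq h1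
    have e2 := eq_of_signOf_eq h2
    rw [decide_eq_true hx₁] at e1
    rw [decide_eq_false hx₂] at e2
    exact Bool.false_ne_true (e2.trans e1.symm)
  · exact ten_splitDerivative_unbalanced f g hf hg hΦ u c b₀ hu hc hodd' heven'

end Summit.QuantumAdvantage.QuantumAdvantage.Theorems.CubicForrelation.NearExactIsExact
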